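import Mathlib
import Summits.Ventures.PercRepro2.Defs
import Summits.Ventures.PercRepro2.Graph
import Summits.Ventures.PercRepro2.OneColourSwitch
import Summits.Ventures.PercRepro2.RegionHubSign
import Summits.Ventures.PercRepro2.SideSwitch
import Summits.Ventures.PercRepro2.TermSwitchDefs
import Summits.Ventures.PercRepro2.TermSwitchReach
import Summits.Ventures.PercRepro2.M9NoPocketDefs
import Summits.Ventures.PercRepro2.M9Unreached
import Summits.Ventures.PercRepro2.M9GeneralDSplit
import Summits.Ventures.PercRepro2.M9ReachedSum

/-!
# The four parts of the single-`d` sum: `dSignSum = N + L_z + EX + HD` (blind cell PercRepro2,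
p3 g30, 2026-08-28; `proofs/P3-HDR.md` §9(c))

`dSignSum(d)` splits pointwise into the unreached part `N = unreachedSum`, the clean one-sided
reached part `L_z = cleanReachedSum`, the doubly-reached part `EX = exSum` (`d ∈ K₂ ∩ M₂`) and
the hub–dead-end part `HD = hdSum` (`dSignSum_eq_four_parts`).  With the theorems `N ≤ 0`
(`M9Unreached`) and `L_z + HD ≤ 0` (`M9ReachedSum`), **the general single-`d` statement follows
from the two census-true conjectures `EX + HD ≤ 0` and `L_z ≤ 0`** (`dSignSum_nonpos_of_exhd_lz`)
— or, alternatively, from `EX + HD ≤ 0` and `N + L_z ≤ 0` (`dSignSum_nonpos_of_exhd_nlz`).  Own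
work; std axioms.
-/

namespace Summit.Ventures.PercRepro2

namespace NoPocket

open Finset Classical RegionHub OneColourSwitch SideSwitch TermSwitch

variable {V : Type*} {E : Type*}

section FourParts

variable [Fintype V] [DecidableEq V] [Fintype E] [DecidableEq E] {ends : E → Sym2 V}
  {p q r s d : V}

/-- The doubly-reached part `EX`: `Σ_{Sep ∧ DOne ∧ d ∈ K₂ ∩ M₂} σ_pq σ_rs`. -/
noncomputable def exSum (ends : E → Sym2 V) (p q r s d : V) : ℤ :=
  ∑ ω : Config E, if sep2 ends p q r s ω ∧ DOne ends r s d ω ∧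
      (d ∈ K2 ends r s ω ∧ d ∈ M2 ends r s ω) then
    sigma ends ω p q * sigma ends ω r s else 0

omit [Fintype V] [DecidableEq V] [Fintype E] [DecidableEq E] in
/-- The pointwise split of the single-`d` family by «`d` doubly reached». -/
lemma dSign_term_split (ω : Config E) :
    (if sep2 ends p q r s ω ∧ DOne ends r s d ω then sigma ends ω p q * sigma ends ω r s
      else 0) =
      (if sep2 ends p q r s ω ∧ DOne ends r s d ω ∧ ¬ (d ∈ K2 ends r s ω ∧ d ∈ M2 ends r s ω)
        then sigma ends ω p q * sigma ends ω r s else 0) +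
      (if sep2 ends p q r s ω ∧ DOne ends r s d ω ∧ (d ∈ K2 ends r s ω ∧ d ∈ M2 ends r s ω)
        then sigma ends ω p q * sigma ends ω r s else 0) := by
  by_cases h0 : sep2 ends p q r s ω ∧ DOne ends r s d ω
  · by_cases hb : d ∈ K2 ends r s ω ∧ d ∈ M2 ends r s ω
    · rw [if_pos h0, if_neg (fun h => h.2.2 hb), if_pos ⟨h0.1, h0.2, hb⟩, zero_add]
    · rw [if_pos h0, if_pos ⟨h0.1, h0.2, hb⟩, if_neg (fun h => hb h.2.2), add_zero]
  · rw [if_neg h0, if_neg (fun h => h0 ⟨h.1, h.2.1⟩), if_neg (fun h => h0 ⟨h.1, h.2.1⟩), add_zero]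

omit [Fintype V] [DecidableEq V] in
/-- **`dSignSum = dzeroOneSum + exSum`.** -/
theorem dSignSum_eq_dzeroOne_add_ex :
    dSignSum ends p q r s d = dzeroOneSum ends p q r s d + exSum ends p q r s d := by
  unfold dSignSum dzeroOneSum exSum
  rw [← Finset.sum_add_distrib]
  exact Finset.sum_congr rfl fun ω _ => dSign_term_split ω

omit [Fintype V] [DecidableEq V] in
/-- **The four parts: `dSignSum = N + L_z + EX + HD`.** -/
theorem dSignSum_eq_four_parts :
    dSignSum ends p q r s d = unreachedSum ends p q r s d + cleanReachedSum ends p q r s d +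
      exSum ends p q r s d + hdSum ends p q r s d := by
  rw [dSignSum_eq_dzeroOne_add_ex, dzeroOneSum_eq_add, reachedOneSum_eq_clean_add_hd]
  ring

/-- **The single-`d` statement from `EX + HD ≤ 0` and `L_z ≤ 0`.** -/
theorem dSignSum_nonpos_of_exhd_lz
    (h1 : exSum ends p q r s d + hdSum ends p q r s d ≤ 0)
    (h2 : cleanReachedSum ends p q r s d ≤ 0) : dSignSum ends p q r s d ≤ 0 := by
  rw [dSignSum_eq_four_parts]
  have h3 := unreachedSum_nonpos (ends := ends) (p := p) (q := q) (r := r) (s := s) (d := d)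
  linarith

omit [Fintype V] [DecidableEq V] in
/-- **The single-`d` statement from `EX + HD ≤ 0` and `N + L_z ≤ 0`.** -/
theorem dSignSum_nonpos_of_exhd_nlz
    (h1 : exSum ends p q r s d + hdSum ends p q r s d ≤ 0)
    (h2 : unreachedSum ends p q r s d + cleanReachedSum ends p q r s d ≤ 0) :
    dSignSum ends p q r s d ≤ 0 := by
  rw [dSignSum_eq_four_parts]
  linarith

/-- **`dSignSum ≤ EX + N`** for every non-mark `d`: by REACH the reached one-sided part
`L_z + HD` is non-positive, so the single-`d` sum is at most the doubly-reached part plus the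
unreached part. -/
theorem dSignSum_le_ex_add_unreached (hr : d ≠ r) (hs : d ≠ s) :
    dSignSum ends p q r s d ≤ exSum ends p q r s d + unreachedSum ends p q r s d := by
  rw [dSignSum_eq_four_parts]
  have h := reachedOneSum_nonpos (ends := ends) (p := p) (q := q) hr hs
  rw [reachedOneSum_eq_clean_add_hd] at h
  linarith

end FourParts

end NoPocket

end Summit.Ventures.PercRepro2
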